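import Summits.ABC.StewartYu.PadicG3ExitC
import Summits.ABC.StewartYu.PadicG3ParD
import HarnessLib

/-!
# Cell abc-stewartyu, Gen-3 frame at `p = 2` (crux `Y07Two`, stmt-ABC-19659), closer glue: the HEADLINE of the
# `p = 2` ledger — the frame's smallness exponent is below `2^{110 n}·Ω·(W + log 2A_max)`

`Summits/ABC/StewartYu/PadicG3TwoHeadline.lean` — cell `abc-stewartyu` (HOME `run/shared/lean/pub/abc-stewartyu/`),
route `PadicPrimesKummerThird`, seat p3 (g6, F-two lead).  Theorems only (real arithmetic on the parameter ledger
`P : PadicG3Par n` with `p = 2`, `K₀ = 1`, `θ₀ = 2`, `N_q ≤ 2ⁿK`, `Amax ≤ 2ⁿΩ`, `Aⱼ ≥ 1`).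

The frame needs `‖Λ₀‖ ≤ 2^{−U}` with `U = (m+6)·(n+2)·3^{n+4}·X·L + m + 3 + ⌈2W⌉` (`PadicG3TwoFirstExp` + the slab
smallness + `|b_θ| ≤ e^W ≤ 2^{2W}`); the negated crux bound supplies `ord₂(Θ − 1) > C(n)·∏ⱼVⱼ·(W + log 2Vmax)`.
This file proves **`headline_two`**: `U ≤ 2^{110·n}·Ω·(W + log(2·Amax))` from the ledger's own upper bounds:
`m ≤ 12.1(n+1)` (`m_le`), `K = 2^m ≤ 2^{13}·(2ⁿ)^{12}` (`K_le`, `e⁸ ≤ 2^{12}`), `L ≤ (264·C_bⁿ + 2^{2n+26})·K·Ω ≤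
2^{40}·(2ⁿ)^{19}·Ω` (`L_le_KΩ`, `C_b ≤ 87`), `W_L ≤ 2.2 + W + log L`, `log L ≤ (19n+40)·log 2 + n·log Amax`
(`Ω ≤ Amaxⁿ`), `X ≤ 2^{28}·(n+1)·(W + log 2Amax)`.  So the engine constant of crux `Y07Two` may be taken
`C(n) = 2^{110·n}` (any `c₁ ≥ 2^{110}`), an absolute-constant-to-the-rank shape as the thesis demands.

WHAT THIS IS NOT: the frame, the record, the closer; no crux moves.

References: Yu. V. Nesterenko, LNM 1819 (2003), §3.5 (3.23) and Prop 3.9; K. Yu, Acta Math. 211 (2013), §3.1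
(3.1)–(3.9).
-/

noncomputable section

open Finset Real

namespace Summit.ABC.StewartYu

namespace PadicG3Par

variable {n : ℕ} (P : PadicG3Par n)

/-- `log 2 ≥ 0.69`, `log 2 ≤ 0.7`, `log 3 ≤ 6/5`. [folklore] -/
theorem log_consts : (69 / 100 : ℝ) ≤ Real.log 2 ∧ Real.log 2 ≤ 7 / 10 ∧ Real.log 3 ≤ 6 / 5 := by
  refine ⟨by have := Real.log_two_gt_d9; linarith, by have := Real.log_two_lt_d9; linarith, ?_⟩
  have h : Real.log 3 = Real.log 2 + Real.log (3 / 2) := by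
    rw [← Real.log_mul (by norm_num) (by norm_num)]; norm_num
  have h2 : Real.log (3 / 2 : ℝ) ≤ 3 / 2 - 1 := Real.log_le_sub_one_of_pos (by norm_num)
  rw [h]; have := Real.log_two_lt_d9; linarith

/-- `e⁸ ≤ 2¹²`, hence `e^{8(n+1)} ≤ (2^{12})^{n+1}`. [folklore] -/
theorem exp_eight_mul_le (k : ℕ) : Real.exp (8 * (k : ℝ)) ≤ (2 : ℝ) ^ (12 * k) := by
  have h1 : Real.exp (8 * (k : ℝ)) = (Real.exp 1 ^ 8) ^ k := by
    rw [← pow_mul, Real.exp_one_pow]; push_cast; ring_nf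
  have h2 : Real.exp 1 ^ 8 ≤ (2 : ℝ) ^ 12 := by
    have he := Real.exp_one_lt_d9
    have he0 : 0 ≤ Real.exp 1 := (Real.exp_pos 1).le
    calc Real.exp 1 ^ 8 ≤ (2.7182818286 : ℝ) ^ 8 := pow_le_pow_left₀ he0 he.le 8
      _ ≤ (2 : ℝ) ^ 12 := by norm_num
  rw [h1, pow_mul]
  exact pow_le_pow_left₀ (by positivity) h2 k

/-- `(n+1)³ ≤ 8ⁿ` for `n ≥ 1`. [folklore] -/
theorem succ_pow_three_le (k : ℕ) (hk : 1 ≤ k) : ((k : ℝ) + 1) ^ 3 ≤ (8 : ℝ) ^ k := by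
  have h : ∀ j : ℕ, ((j : ℝ) + 2) ^ 3 ≤ (8 : ℝ) ^ (j + 1) := by
    intro j
    induction j with
    | zero => norm_num
    | succ j ih =>
      have hj : (0 : ℝ) ≤ j := by positivity
      calc (((j + 1 : ℕ) : ℝ) + 2) ^ 3 = (((j : ℝ) + 2) + 1) ^ 3 := by push_cast; ring
        _ ≤ 8 * ((j : ℝ) + 2) ^ 3 := by nlinarith [sq_nonneg ((j : ℝ) + 2), sq_nonneg ((j:ℝ) + 1)]
        _ ≤ 8 * (8 : ℝ) ^ (j + 1) := by linarith
        _ = (8 : ℝ) ^ (j + 1 + 1) := by rw [pow_succ]; ring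
  obtain ⟨j, rfl⟩ : ∃ j, k = j + 1 := ⟨k - 1, by omega⟩
  have := h j
  push_cast
  calc ((j : ℝ) + 1 + 1) ^ 3 = ((j : ℝ) + 2) ^ 3 := by ring
    _ ≤ (8 : ℝ) ^ (j + 1) := this

/-! ### The ledger's quantities under `p = 2`, `K₀ = 1`, `θ₀ = 2` -/

/-- **`m ≤ 12.1·(n+1)`** at `p = 2`. [folklore] -/
theorem m_le_two (hp : P.p = 2) : (P.m : ℝ) ≤ (121 / 10) * ((n : ℝ) + 1) := by
  have h := P.m_le
  have hp' : (P.p : ℝ) = 2 := by exact_mod_cast hp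
  rw [hp'] at h
  unfold cG at h
  obtain ⟨hl, _, _⟩ := log_consts
  have hn : (1 : ℝ) ≤ (n : ℝ) := by exact_mod_cast P.hn
  have h1 : 8 * ((n : ℝ) + 1) / Real.log 2 ≤ 8 * ((n : ℝ) + 1) / (69 / 100) :=
    div_le_div_of_nonneg_left (by positivity) (by norm_num) hl
  have h2 : 8 * ((n : ℝ) + 1) / (69 / 100) = (800 / 69) * ((n : ℝ) + 1) := by ring
  rw [h2] at h1
  nlinarith

/-- **`K ≤ 2^{13}·(2ⁿ)^{12}`** at `p = 2`, `K₀ = 1` (`K = 2^m ≤ 2·e^{8(n+1)}`). [folklore] -/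
theorem K_le_two (hp : P.p = 2) (hK₀ : P.K₀ = 1) : (P.K : ℝ) ≤ (2 : ℝ) ^ 13 * ((2 : ℝ) ^ n) ^ 12 := by
  have h := P.K_le
  have hp' : (P.p : ℝ) = 2 := by exact_mod_cast hp
  have hK₀' : (P.K₀ : ℝ) = 1 := by exact_mod_cast hK₀
  rw [hp', hK₀', one_mul] at h
  unfold cG at h
  have he := exp_eight_mul_le (n + 1)
  push_cast at he
  have e : (2 : ℝ) ^ (12 * (n + 1)) = 2 ^ 12 * ((2 : ℝ) ^ n) ^ 12 := by
    rw [← pow_mul, show 12 * (n + 1) = 12 + n * 12 by ring, pow_add]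
  rw [e] at he
  nlinarith [pow_nonneg (show (0:ℝ) ≤ (2:ℝ)^n by positivity) 12]

/-- **`L ≤ 2^{40}·(2ⁿ)^{19}·Ω`** under the instantiation facts. [cite: Nesterenko2003, §3.5 (3.23); shape only] -/
theorem L_le_two (hp : P.p = 2) (hK₀ : P.K₀ = 1) (hθ : (1 / 2 : ℝ) ≤ P.θ₀) (hNqK : P.Nq ≤ 2 ^ n * P.K)
    (hAmax : P.Amax ≤ 2 ^ n * P.Ω) (hA1 : ∀ j, 1 ≤ P.A j) :
    (P.L : ℝ) ≤ (2 : ℝ) ^ 40 * ((2 : ℝ) ^ n) ^ 19 * P.Ω := by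
  have hL := P.L_le_KΩ hθ hNqK hAmax hA1
  have hK := P.K_le_two hp hK₀
  have hCb := Cb_le
  have hCb0 : (0 : ℝ) ≤ Cb := le_trans (by norm_num) sixtyfour_le_Cb
  have hΩ := P.Ω_pos
  set E : ℝ := (2 : ℝ) ^ n with hE
  have hE1 : 1 ≤ E := one_le_pow₀ (by norm_num)
  -- `Cbⁿ ≤ 128ⁿ = E^7`, `2^{2n+26} = 2^26·E^2`
  have hCbn : Cb ^ n ≤ E ^ 7 := by
    calc Cb ^ n ≤ (128 : ℝ) ^ n := pow_le_pow_left₀ hCb0 (by linarith) n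
      _ = E ^ 7 := by rw [hE, ← pow_mul, show (128:ℝ) = 2^7 by norm_num, ← pow_mul, mul_comm]
  have h26 : (2 : ℝ) ^ (2 * n + 26) = 2 ^ 26 * E ^ 2 := by
    rw [hE, ← pow_mul, pow_add, mul_comm n 2, pow_mul]; ring
  have hcoef : 264 * Cb ^ n + (2 : ℝ) ^ (2 * n + 26) ≤ 2 ^ 27 * E ^ 7 := by
    rw [h26]
    have hE2 : E ^ 2 ≤ E ^ 7 := pow_le_pow_right₀ hE1 (by norm_num)
    nlinarith [pow_nonneg (show (0:ℝ) ≤ E by positivity) 7]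
  have hKΩ : 0 ≤ (P.K : ℝ) * P.Ω := by have := P.K_pos; positivity
  calc (P.L : ℝ) ≤ (264 * Cb ^ n + 2 ^ (2 * n + 26)) * P.K * P.Ω := hL
    _ ≤ (2 ^ 27 * E ^ 7) * (2 ^ 13 * E ^ 12) * P.Ω := by
        rw [mul_assoc, mul_assoc]
        exact mul_le_mul hcoef (mul_le_mul_of_nonneg_right hK hΩ.le) hKΩ (by positivity)
    _ = (2 : ℝ) ^ 40 * E ^ 19 * P.Ω := by ring

/-- **`W_L ≤ 11/5 + W + log L`** (`1 + 2e^W L ≤ 3e^W L`). [folklore] -/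
theorem WL_le_log : P.WL ≤ 11 / 5 + P.W + Real.log P.L := by
  rw [P.WL_eq]
  have hL := P.one_le_L
  have hW := P.hW
  have heW : 1 ≤ Real.exp P.W := Real.one_le_exp (by linarith)
  have h1 : 1 + 2 * Real.exp P.W * P.L ≤ 3 * (Real.exp P.W * P.L) := by nlinarith
  have hpos : 0 < 1 + 2 * Real.exp P.W * P.L := by positivity
  have h2 := Real.log_le_log hpos h1
  rw [Real.log_mul (by norm_num) (by positivity), Real.log_mul (by positivity) (by positivity), Real.log_exp] at h2
  obtain ⟨_, _, h3⟩ := log_consts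
  linarith

/-- **`log L ≤ (19n+40)·(7/10) + n·log(2·Amax)`.** [folklore] -/
theorem log_L_le_two (hp : P.p = 2) (hK₀ : P.K₀ = 1) (hθ : (1 / 2 : ℝ) ≤ P.θ₀) (hNqK : P.Nq ≤ 2 ^ n * P.K)
    (hAmax : P.Amax ≤ 2 ^ n * P.Ω) (hA1 : ∀ j, 1 ≤ P.A j) :
    Real.log P.L ≤ (19 * (n : ℝ) + 40) * (7 / 10) + n * Real.log (2 * P.Amax) := by
  have hL := P.L_le_two hp hK₀ hθ hNqK hAmax hA1
  have hL1 := P.one_le_L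
  have hΩ := P.Ω_pos
  have hA1' := P.hAmax1
  have h := Real.log_le_log (by linarith) hL
  rw [Real.log_mul (by positivity) hΩ.ne', Real.log_mul (by positivity) (by positivity), ← pow_mul, Real.log_pow,
    Real.log_pow] at h
  have hΩle : Real.log P.Ω ≤ n * Real.log (2 * P.Amax) := by
    have h1 := Real.log_le_log hΩ P.Ω_le_pow
    rw [Real.log_pow] at h1
    have h2 : Real.log P.Amax ≤ Real.log (2 * P.Amax) := Real.log_le_log (by linarith) (by linarith)
    have hn0 : (0 : ℝ) ≤ n := by positivity
    nlinarith
  obtain ⟨_, hl2, _⟩ := log_consts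
  have hn0 : (0 : ℝ) ≤ n := by positivity
  push_cast at h
  nlinarith

/-- **`X ≤ 2^{28}·(n+1)·(W + log 2Amax)`.** [cite: Nesterenko2003, Prop 3.9; shape only] -/
theorem X_le_two (hp : P.p = 2) (hK₀ : P.K₀ = 1) (hθ : (1 / 2 : ℝ) ≤ P.θ₀) (hNqK : P.Nq ≤ 2 ^ n * P.K)
    (hAmax : P.Amax ≤ 2 ^ n * P.Ω) (hA1 : ∀ j, 1 ≤ P.A j) :
    (P.X : ℝ) ≤ (2 : ℝ) ^ 28 * ((n : ℝ) + 1) * (P.W + Real.log (2 * P.Amax)) := by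
  have hWL := P.WL_le_log
  have hlogL := P.log_L_le_two hp hK₀ hθ hNqK hAmax hA1
  have hLKΩ := P.L_le_KΩ hθ hNqK hAmax hA1
  have hG8 : 8 * ((n : ℝ) + 1) ≤ P.G := by have := P.n_le; linarith
  have hGpos : 0 < P.G := by linarith [P.eight_le_G]
  have hW := P.hW
  have hA := P.hAmax1
  have hℓ : Real.log 2 ≤ Real.log (2 * P.Amax) := Real.log_le_log (by norm_num) (by linarith)
  obtain ⟨hl2, _, _⟩ := log_consts
  have hℓ0 : 0 ≤ Real.log (2 * P.Amax) := by linarith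
  have hWL0 : 0 ≤ P.WL := le_trans zero_le_one P.WL_ge_one
  have hn0 : (0 : ℝ) ≤ n := by positivity
  -- the two branches of `X`
  set a : ℝ := 64 * (n + 1) * P.WL / P.G with ha
  set b : ℝ := (3 / 2) * (n + 1) * P.L / (Cb ^ n * P.Ω * P.K) with hb
  have ha0 : 0 ≤ a := by positivity
  have hcore := P.core_pos
  have hCb64 : (64 : ℝ) ≤ Cb := sixtyfour_le_Cb
  have hb0 : 0 ≤ b := by have := P.one_le_L; positivity
  have hX : (P.X : ℝ) ≤ a + b + 2 := by
    have h1 : P.X ≤ ⌈a⌉₊ + ⌈b⌉₊ := by unfold X; exact max_le (Nat.le_add_right _ _) (Nat.le_add_left _ _)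
    have h2 : (P.X : ℝ) ≤ (⌈a⌉₊ : ℝ) + (⌈b⌉₊ : ℝ) := by exact_mod_cast h1
    have h3 := (Nat.ceil_lt_add_one ha0).le
    have h4 := (Nat.ceil_lt_add_one hb0).le
    linarith
  -- `a ≤ 8·WL`
  have ha' : a ≤ 8 * P.WL := by
    rw [ha, div_le_iff₀ hGpos]; nlinarith
  -- `b ≤ (3/2)(n+1)(264 + 2^26)`
  have hb' : b ≤ (3 / 2) * ((n : ℝ) + 1) * (264 + 2 ^ 26) := by
    rw [hb, div_le_iff₀ hcore]
    have hCbn : (4 : ℝ) ^ n ≤ Cb ^ n := pow_le_pow_left₀ (by norm_num) (by linarith) n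
    have h2n : (2 : ℝ) ^ (2 * n + 26) = 2 ^ 26 * (4 : ℝ) ^ n := by
      rw [pow_add, pow_mul]; norm_num; ring
    have hKΩ : (1 : ℝ) ≤ P.K * P.Ω := by
      have hK1 : (1 : ℝ) ≤ P.K := by exact_mod_cast P.one_le_K
      have hΩ1 : (1 : ℝ) ≤ P.Ω := by
        unfold Ω
        calc (1 : ℝ) = ∏ _j : Fin n, (1 : ℝ) := by simp
          _ ≤ ∏ j, P.A j := Finset.prod_le_prod (fun _ _ => zero_le_one) fun j _ => hA1 j
      nlinarith
    have hKΩ0 : (0 : ℝ) ≤ P.K * P.Ω := by linarith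
    calc (3 / 2) * ((n : ℝ) + 1) * P.L ≤ (3 / 2) * ((n : ℝ) + 1) * ((264 * Cb ^ n + 2 ^ (2 * n + 26)) * P.K * P.Ω) := by
          nlinarith
      _ ≤ (3 / 2) * ((n : ℝ) + 1) * (264 + 2 ^ 26) * (Cb ^ n * P.Ω * P.K) := by
          rw [h2n]
          have hc : (264 * Cb ^ n + 2 ^ 26 * (4 : ℝ) ^ n) ≤ (264 + 2 ^ 26) * Cb ^ n := by nlinarith
          have := mul_le_mul_of_nonneg_right hc hKΩ0
          nlinarith
  -- assemble: `X ≤ 8(11/5 + W + log L) + (3/2)(n+1)(264+2^26) + 2`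
  have hlogL' : Real.log P.L ≤ (19 * (n : ℝ) + 40) * (7 / 10) + n * Real.log (2 * P.Amax) := hlogL
  nlinarith

/-! ### The headline -/

/-- **THE HEADLINE OF THE `p = 2` LEDGER**: the closer's smallness exponent
`(m+6)·(n+2)·3^{n+4}·X·L + m + 3 + ⌈2W⌉` is at most `2^{110·n}·Ω·(W + log 2Amax)`.
[cite: Yu2007, Main Thm (K = ℚ, ℘ = 2); shape only] -/
theorem headline_two (hp : P.p = 2) (hK₀ : P.K₀ = 1) (hθ : (1 / 2 : ℝ) ≤ P.θ₀) (hNqK : P.Nq ≤ 2 ^ n * P.K)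
    (hAmax : P.Amax ≤ 2 ^ n * P.Ω) (hA1 : ∀ j, 1 ≤ P.A j) :
    (((P.m + 6) * ((n + 2) * (3 ^ (n + 4) * (P.X * P.L))) + P.m + 3 + ⌈2 * P.W⌉₊ : ℕ) : ℝ) ≤
      (2 : ℝ) ^ (110 * n) * P.Ω * (P.W + Real.log (2 * P.Amax)) := by
  have hm := P.m_le_two hp
  have hL := P.L_le_two hp hK₀ hθ hNqK hAmax hA1
  have hX := P.X_le_two hp hK₀ hθ hNqK hAmax hA1
  have hW := P.hW
  have hA := P.hAmax1
  have hΩ := P.Ω_pos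
  have hn : (1 : ℝ) ≤ n := by exact_mod_cast P.hn
  obtain ⟨hl2, _, _⟩ := log_consts
  have hℓ : Real.log 2 ≤ Real.log (2 * P.Amax) := Real.log_le_log (by norm_num) (by linarith)
  have hΩ1 : (1 : ℝ) ≤ P.Ω := by
    unfold Ω
    calc (1 : ℝ) = ∏ _j : Fin n, (1 : ℝ) := by simp
      _ ≤ ∏ j, P.A j := Finset.prod_le_prod (fun _ _ => zero_le_one) fun j _ => hA1 j
  set E : ℝ := (2 : ℝ) ^ n with hE
  set Wℓ : ℝ := P.W + Real.log (2 * P.Amax) with hWℓ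
  have hE2 : 2 ≤ E := by
    rw [hE]; calc (2:ℝ) = 2 ^ 1 := by norm_num
      _ ≤ 2 ^ n := pow_le_pow_right₀ (by norm_num) P.hn
  have hWℓ1 : 1 ≤ Wℓ := by rw [hWℓ]; linarith
  have hX0 : (0 : ℝ) ≤ P.X := by positivity
  have hL0 : (0 : ℝ) ≤ P.L := by positivity
  -- (1) the ceiling and the small terms
  have hceil : ((⌈2 * P.W⌉₊ : ℕ) : ℝ) ≤ 2 * P.W + 1 := (Nat.ceil_lt_add_one (by linarith)).le
  -- (2) `3^{n+4} ≤ 81·E²`, `(n+1)^3 ≤ E^3`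
  have h3n : (3 : ℝ) ^ (n + 4) ≤ 81 * E ^ 2 := by
    rw [pow_add, hE, ← pow_mul, show n * 2 = 2 * n by ring, pow_mul]
    have : (3 : ℝ) ^ n ≤ (4 : ℝ) ^ n := pow_le_pow_left₀ (by norm_num) (by norm_num) n
    norm_num; linarith
  have hn3 : ((n : ℝ) + 1) ^ 3 ≤ E ^ 3 := by
    rw [hE, ← pow_mul, show n * 3 = 3 * n by ring, pow_mul]; norm_num
    exact succ_pow_three_le n P.hn
  -- (3) `X·L ≤ 2^{68}·(n+1)·E^{19}·Ω·Wℓ`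
  have hXL : (P.X : ℝ) * P.L ≤ (2 : ℝ) ^ 68 * ((n : ℝ) + 1) * E ^ 19 * P.Ω * Wℓ := by
    have h := mul_le_mul hX hL hL0 (by positivity)
    have e : (2 : ℝ) ^ 28 * ((n : ℝ) + 1) * Wℓ * ((2 : ℝ) ^ 40 * E ^ 19 * P.Ω) =
        (2 : ℝ) ^ 68 * ((n : ℝ) + 1) * E ^ 19 * P.Ω * Wℓ := by ring
    linarith
  -- (4) `(m+6)(n+2) ≤ 24(n+1)²`
  have hmn : ((P.m : ℝ) + 6) * ((n : ℝ) + 2) ≤ 24 * ((n : ℝ) + 1) ^ 2 := by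
    have h16 : (P.m : ℝ) + 6 ≤ 16 * ((n : ℝ) + 1) := by linarith
    have h15 : (n : ℝ) + 2 ≤ (3 / 2) * ((n : ℝ) + 1) := by linarith
    calc ((P.m : ℝ) + 6) * ((n : ℝ) + 2) ≤ (16 * ((n : ℝ) + 1)) * ((3 / 2) * ((n : ℝ) + 1)) :=
          mul_le_mul h16 h15 (by positivity) (by positivity)
      _ = 24 * ((n : ℝ) + 1) ^ 2 := by ring
  -- (5) main term
  have hmain : ((P.m : ℝ) + 6) * (((n : ℝ) + 2) * ((3 : ℝ) ^ (n + 4) * ((P.X : ℝ) * P.L))) ≤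
      (2 : ℝ) ^ 79 * E ^ 24 * P.Ω * Wℓ := by
    have h1 : ((P.m : ℝ) + 6) * (((n : ℝ) + 2) * ((3 : ℝ) ^ (n + 4) * ((P.X : ℝ) * P.L))) =
        (((P.m : ℝ) + 6) * ((n : ℝ) + 2)) * (3 : ℝ) ^ (n + 4) * ((P.X : ℝ) * P.L) := by ring
    rw [h1]
    have hXL0 : (0 : ℝ) ≤ (P.X : ℝ) * P.L := by positivity
    have h2 : (((P.m : ℝ) + 6) * ((n : ℝ) + 2)) * (3 : ℝ) ^ (n + 4) ≤ (24 * ((n : ℝ) + 1) ^ 2) * (81 * E ^ 2) :=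
      mul_le_mul hmn h3n (by positivity) (by positivity)
    have h3 := mul_le_mul h2 hXL hXL0 (by positivity)
    have h4 : (24 * ((n : ℝ) + 1) ^ 2) * (81 * E ^ 2) * ((2 : ℝ) ^ 68 * ((n : ℝ) + 1) * E ^ 19 * P.Ω * Wℓ) =
        (1944 * 2 ^ 68) * (((n : ℝ) + 1) ^ 3) * (E ^ 21 * P.Ω * Wℓ) := by ring
    rw [h4] at h3
    have hrest : 0 ≤ E ^ 21 * P.Ω * Wℓ := by positivity
    have h5 : (1944 * 2 ^ 68) * (((n : ℝ) + 1) ^ 3) * (E ^ 21 * P.Ω * Wℓ) ≤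
        (1944 * 2 ^ 68) * E ^ 3 * (E ^ 21 * P.Ω * Wℓ) :=
      mul_le_mul_of_nonneg_right (mul_le_mul_of_nonneg_left hn3 (by norm_num)) hrest
    have h6 : (1944 * 2 ^ 68) * E ^ 3 * (E ^ 21 * P.Ω * Wℓ) ≤ (2 : ℝ) ^ 79 * E ^ 3 * (E ^ 21 * P.Ω * Wℓ) := by
      have hE3 : 0 ≤ E ^ 3 * (E ^ 21 * P.Ω * Wℓ) := by positivity
      have : ((1944 : ℝ) * 2 ^ 68) ≤ 2 ^ 79 := by norm_num
      nlinarith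
    have e7 : (2 : ℝ) ^ 79 * E ^ 3 * (E ^ 21 * P.Ω * Wℓ) = (2 : ℝ) ^ 79 * E ^ 24 * P.Ω * Wℓ := by ring
    linarith
  -- (6) small terms: `m + 3 + 2W + 1 ≤ 2^5·E·Ω·Wℓ`
  have hsmall : (P.m : ℝ) + 3 + (2 * P.W + 1) ≤ (2 : ℝ) ^ 5 * E * P.Ω * Wℓ := by
    have h1 : (P.m : ℝ) + 4 ≤ 15 * ((n : ℝ) + 1) := by linarith
    have h2 : ((n : ℝ) + 1) ≤ E := by
      rw [hE]
      have : ∀ k : ℕ, ((k : ℝ) + 1) ≤ (2 : ℝ) ^ k := fun k => by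
        induction k with
        | zero => norm_num
        | succ k ih => push_cast; rw [pow_succ]; linarith [one_le_pow₀ (show (1:ℝ) ≤ 2 by norm_num) (n := k)]
      exact this n
    have h3 : 2 * P.W ≤ 2 * Wℓ := by rw [hWℓ]; linarith
    have hE1 : (1 : ℝ) ≤ E := by linarith
    -- `15(n+1) ≤ 15 E ≤ 15 E Ω Wℓ`, `2W ≤ 2Wℓ ≤ 2 E Ω Wℓ`
    have hEΩW : E ≤ E * P.Ω * Wℓ := by
      have := mul_le_mul (le_refl E) (one_le_mul_of_one_le_of_one_le hΩ1 hWℓ1) (by norm_num) (by linarith)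
      rw [mul_one] at this; linarith [this, show E * (P.Ω * Wℓ) = E * P.Ω * Wℓ by ring]
    have hWℓ' : Wℓ ≤ E * P.Ω * Wℓ := by
      have := mul_le_mul_of_nonneg_right (one_le_mul_of_one_le_of_one_le hE1 hΩ1) (by linarith : (0:ℝ) ≤ Wℓ)
      linarith
    linarith
  -- (7) `2^79 E^24 + 2^5 E ≤ 2^80 E^24 ≤ E^110`
  have hfin : (2 : ℝ) ^ 79 * E ^ 24 * P.Ω * Wℓ + (2 : ℝ) ^ 5 * E * P.Ω * Wℓ ≤ E ^ 110 * P.Ω * Wℓ := by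
    have hpos : 0 ≤ P.Ω * Wℓ := by positivity
    have h1 : E ≤ E ^ 24 := by
      calc E = E ^ 1 := (pow_one E).symm
        _ ≤ E ^ 24 := pow_le_pow_right₀ (by linarith) (by norm_num)
    have h2 : (2 : ℝ) ^ 80 * E ^ 24 ≤ E ^ 110 := by
      have : (2 : ℝ) ^ 80 ≤ E ^ 86 := by
        calc (2 : ℝ) ^ 80 ≤ 2 ^ 86 := by norm_num
          _ ≤ E ^ 86 := pow_le_pow_left₀ (by norm_num) hE2 86
      have e : E ^ 110 = E ^ 86 * E ^ 24 := by ring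
      rw [e]; exact mul_le_mul_of_nonneg_right this (by positivity)
    have h3 : (2 : ℝ) ^ 5 * E ≤ (2 : ℝ) ^ 79 * E ^ 24 := by
      have : (2:ℝ) ^ 5 ≤ 2 ^ 79 := by norm_num
      nlinarith [show (0:ℝ) ≤ E by linarith]
    have h4 := mul_le_mul_of_nonneg_right h2 hpos
    have h5 := mul_le_mul_of_nonneg_right h3 hpos
    have e1 : (2 : ℝ) ^ 79 * E ^ 24 * P.Ω * Wℓ = ((2 : ℝ) ^ 79 * E ^ 24) * (P.Ω * Wℓ) := by ring
    have e2 : (2 : ℝ) ^ 5 * E * P.Ω * Wℓ = ((2 : ℝ) ^ 5 * E) * (P.Ω * Wℓ) := by ring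
    have e3 : E ^ 110 * P.Ω * Wℓ = E ^ 110 * (P.Ω * Wℓ) := by ring
    have e4 : ((2 : ℝ) ^ 80 * E ^ 24) * (P.Ω * Wℓ) = 2 * (((2 : ℝ) ^ 79 * E ^ 24) * (P.Ω * Wℓ)) := by ring
    linarith
  have hE110 : E ^ 110 = (2 : ℝ) ^ (110 * n) := by rw [hE, ← pow_mul, mul_comm]
  push_cast
  rw [← hE110]
  linarith

end PadicG3Par

end Summit.ABC.StewartYu

end
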